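import Summits.ABC.IUTFork.Joshi.TestEvenScaling
import Summits.ABC.IUTFork.Joshi.DictionaryUntiltsReadout
import Summits.ABC.IUTFork.Joshi.UntiltFrobeniusLine
import HarnessLib

/-!
# Block E — the [J-I] LOG read-out at COUNTERMODEL #3: a log-faithful, equivariant, dilating [J-I] dictionary REALISED where S is FALSE

Record file (D-0012) of the abc-iut cell, block E «type Joshi's construction, test vs S» (rung LADDER-ABC:A2.E; seat abc-iut-E-cx-3,
THIRD block-E adversary; lane (1) «[J-I] cluster vs S»; announced 2026-08-26T10:56:38Z). Target sentence S =
`Summit.ABC.IUTFork.Cor312Vol.PilotKummerIndRelated`. TAKES NO SIDE; typed ≠ proved.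

**Tested sentence.** abc-iut-E-t1's re-typed [J-I] residual `UntiltPoints.ExponentLogFaithful` (p438244: in some packet
`logvol (ρ (datum y)) = κ · log (exponent y) + c`, **∃ κ ≠ 0**) together with the Y₁-components `MovesAreInd ∧ DatumEquivariant`
(+ `BaseIsThetaPilot`, `StdReachable`) and Joshi's `ActionDilates`, on E-t1's Frobenius-line signature `frobLine p ℓ b hb` (p438828:
`exponent (σ·y) = b^{v_ℓ(σ 1)} · exponent y`).

**Finding (kernel-checked).** At the even-power model (`Joshi/TestEvenScaling`: Ism `= {x ↦ ±q^{2k}·x}`, typed Thm 3.11 ∧ PinnedRegions3,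
S FALSE by parity) the dictionary `evenLineDictionary` — datum of the point `y` := the translate of the Θ-monoid datum `Ψ_v` by
`squareFamily ^ idx y`, realisation of the move `σ` := `squareFamily ^ v_ℓ(σ 1) ∈ ⟨(Ind1) ∪ (Ind2)⟩` — satisfies
`BaseIsThetaPilot ∧ MovesAreInd ∧ DatumEquivariant ∧ StdReachable ∧ AnsatzWithinInd ∧ ExponentLogFaithful` (with `κ = −2·log q / log b`)
`∧ ActionDilates` (b ≠ 1) — and `¬ StandardPointIsQPilot ∧ ¬S` (`frobLine_even_countermodel`). So the κ-FREE log read-out is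
REALISED at a ¬S model: the re-typed residual does not co-vary with S across the three models of record (pinned p419720: unrealisable,
`LogvolInvariant`; X-07′: realised ∧ S; even: realised ∧ ¬S). p438244's location `not_movesAreInd_and_datumEquivariant_of_logFaithful` is
not contradicted: its hypothesis `MRData.LogvolInvariant` FAILS here (`evenSetting_not_logvolInvariant`). What would make the residual track S:
PIN κ to the q-parameter's unit per Frobenius step AND make the read-out LABEL-DEPENDENT (S needs the shift `1 − j²` at the label `j`;
a uniform dilatation shifts every label alike) — recorded for E-t1 / E-plan, not typed here.
[claim: Joshi2021ATS1, status: disputed] [claim: Mochizuki2012, status: disputed] [cite: ScholzeStix2018, §2.2 pp. 9–10]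
-/

noncomputable section

open Set

namespace Summit.ABC.IUTFork.Joshi.EvenScaling

open Thm311 Cor312 Cor312.Checks Cor312.IdentifiedNonVacuity Cor312Vol Cor312Vol.NaiveWitness Cor312Vol.PinnedWitness
  Literature.IUT.LogThetaLattice IsmScaling IsmPartial UntiltPoints FrobLine

variable (q : ℕ) [hq : Fact q.Prime]

/-! ## 1. Powers of `squareFamily` and the translated Θ-data -/

/-- `squareFamily ^ k` carries `B_e` onto `B_{e+2k}` (integer powers in the group of packet-automorphism families). [folklore] -/
theorem image_pBall_squareFamily_zpow (j : toyIndex.Label) (vQ : toyIndex.VQ) (k e : ℤ) :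
    (squareFamily q ^ k) j vQ '' pBall q j vQ e = pBall q j vQ (e + 2 * k) := by
  induction k using Int.induction_on generalizing e with
  | zero =>
    have h1 : ∀ x, (squareFamily q ^ (0 : ℤ)) j vQ x = x := fun x => by rw [zpow_zero]; rfl
    rw [mul_zero, add_zero]
    ext y
    constructor
    · rintro ⟨x, hx, rfl⟩; rw [h1]; exact hx
    · exact fun hy => ⟨y, hy, h1 y⟩
  | succ n ih =>
    have h1 : ∀ x, (squareFamily q ^ ((n : ℤ) + 1)) j vQ x =
        (squareFamily q ^ (n : ℤ)) j vQ (squareFamily q j vQ x) := fun x => by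
      rw [zpow_add_one]; rfl
    have himg : (squareFamily q ^ ((n : ℤ) + 1)) j vQ '' pBall q j vQ e =
        (squareFamily q ^ (n : ℤ)) j vQ '' (squareFamily q j vQ '' pBall q j vQ e) := by
      rw [Set.image_image]; exact Set.image_congr fun x _ => h1 x
    have hsq : squareFamily q j vQ '' pBall q j vQ e = pBall q j vQ (e + 2) := by
      have h := image_pBall_evenFamily q 1 j vQ e
      rw [mul_one] at h
      exact h
    rw [himg, hsq, ih]
    congr 1; ring
  | pred n ih =>
    have h1 : ∀ x, (squareFamily q ^ (-(n : ℤ) - 1)) j vQ x =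
        (squareFamily q ^ (-(n : ℤ))) j vQ ((squareFamily q j vQ).symm x) := fun x => by
      rw [zpow_sub_one]; rfl
    have himg : (squareFamily q ^ (-(n : ℤ) - 1)) j vQ '' pBall q j vQ e =
        (squareFamily q ^ (-(n : ℤ))) j vQ '' ((squareFamily q j vQ).symm '' pBall q j vQ e) := by
      rw [Set.image_image]; exact Set.image_congr fun x _ => h1 x
    have hsq : (squareFamily q j vQ).symm '' pBall q j vQ e = pBall q j vQ (e - 2) := by
      have h := image_pBall_evenFamily q 1 j vQ (e - 2)
      rw [mul_one, sub_add_cancel] at h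
      rw [← h, Set.image_image]
      exact (Set.image_congr fun x _ => (squareFamily q j vQ).symm_apply_apply x).trans (Set.image_id' _)
    rw [himg, hsq, ih]
    congr 1; ring

/-- `squareFamily ^ k ∈ ⟨(Ind1) ∪ (Ind2)⟩` of the even situation. [folklore] -/
theorem squareFamily_zpow_mem_indGroup (k : ℤ) : squareFamily q ^ k ∈ Setting.indGroup (evenSituation q) :=
  Subgroup.zpow_mem _ (evenFamily_mem_indGroup q 1) k

/-- **The translated Θ-data** `Ψ_v^{(k)} := (squareFamily ^ k) · Ψ_v` (the datum read in a holomorphic structure of index `k`). [folklore] -/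
def evenDatum (k : ℤ) : ∀ v : toyIndex.V, v ∈ toyIndex.Vbad → Set ((evenShells q).StarPacket v) :=
  fun v _ => (evenShells q).starAut (squareFamily q ^ k) v '' Psi q v

omit hq in
/-- Acting by `Φ * Ψ` on tuple sets is acting by `Ψ`, then by `Φ` (image form of `starAut_mul`). [folklore] -/
theorem starAut_mul_image (Φ Ψ : (evenShells q).PacketAut) (v : toyIndex.V) (X : Set ((evenShells q).StarPacket v)) :
    (evenShells q).starAut (Φ * Ψ) v '' X = (evenShells q).starAut Φ v '' ((evenShells q).starAut Ψ v '' X) := by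
  rw [Set.image_image]; rfl

/-- Translation law: `Ψ^{(a+k)} = (squareFamily ^ a) · Ψ^{(k)}`. [folklore] -/
theorem evenDatum_add (a k : ℤ) (v : toyIndex.V) (hv : v ∈ toyIndex.Vbad) :
    evenDatum q (a + k) v hv = (evenShells q).starAut (squareFamily q ^ a) v '' evenDatum q k v hv := by
  unfold evenDatum
  rw [zpow_add, starAut_mul_image]

/-- `Ψ^{(0)} = Ψ`. [folklore] -/
theorem evenDatum_zero : evenDatum q 0 = fun v _ => Psi q v := by
  funext v hv
  unfold evenDatum
  rw [zpow_zero, LogShells.starAut_one]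
  simp

/-- **The region of `Ψ^{(k)}` is `B_{j²+2k}`** at `j ∈ 𝔽_l^⋇` ((hρ) for every packet automorphism + `scalRegion_Psi`). [folklore] -/
theorem scalRegion_evenDatum {j : toyIndex.Label} (hj : j ≠ 0) (vQ : toyIndex.VQ) (k : ℤ) :
    scalRegion q (evenDatum q k) j vQ = pBall q j vQ (jsq j + 2 * k) := by
  have h := scalRegion_equivariant q (squareFamily q ^ k) (fun v _ => Psi q v) j vQ
  rw [scalRegion_Psi, if_neg hj] at h
  exact h.trans (image_pBall_squareFamily_zpow q j vQ k (jsq j))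

/-! ## 2. The log-faithful [J-I] dictionary on the Frobenius line, at the even model -/

variable (p ℓ : ℕ) [Fact p.Prime] [hℓ : Fact ℓ.Prime] (b : ℝ) (hb : 0 < b)

/-- **The dictionary**: points and moves of E-t1's Frobenius line; base point `[1]` (index `0`), standard point `[ℓ]` (index `1`);
datum of `y` := `Ψ^{(idx y)}`; realisation of `σ` := `squareFamily ^ v_ℓ(σ 1)`. [claim: Joshi2024ATS3, status: disputed] -/
def evenLineDictionary : Dictionary (evenFull q).toLatticeSituation :=
  (frobLine p ℓ b hb).toDictionary (evenFull q).toLatticeSituation (pt 1 one_ne_zero)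
    ((frobLine p ℓ b hb).ptAct (mulAut b hb (ℓ : ℚ) (Nat.cast_ne_zero.2 hℓ.out.ne_zero)) (pt 1 one_ne_zero))
    (fun y => evenDatum q (idx ℓ y)) (fun σ => squareFamily q ^ padicValRat ℓ (σ.toLinearEquiv (1 : ℚ)))

/-- `BaseIsThetaPilot`: the datum of `[1]` is `Ψ_v` itself. [folklore] -/
theorem evenLine_baseIsThetaPilot :
    BaseIsThetaPilot (evenLineDictionary q p ℓ b hb) (P := evenSetting q) := by
  show evenDatum q (idx ℓ (pt 1 one_ne_zero)) = fun v _ => Psi q v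
  rw [idx_one, evenDatum_zero]

/-- `MovesAreInd`: every move is realised in `⟨(Ind1) ∪ (Ind2)⟩` (powers of the (Ind2)-family `squareFamily`). [folklore] -/
theorem evenLine_movesAreInd : MovesAreInd (evenLineDictionary q p ℓ b hb) :=
  fun _ => squareFamily_zpow_mem_indGroup q _

/-- `DatumEquivariant`: `Ψ^{(idx (σ·y))} = (squareFamily ^ v_ℓ(σ 1)) · Ψ^{(idx y)}`. [folklore] -/
theorem evenLine_datumEquivariant : DatumEquivariant (evenLineDictionary q p ℓ b hb) := by
  intro σ y v hv
  show evenDatum q (idx ℓ ((frobLine p ℓ b hb).ptAct σ y)) v hv =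
    (evenShells q).starAut (squareFamily q ^ padicValRat ℓ (σ.toLinearEquiv (1 : ℚ))) v '' evenDatum q (idx ℓ y) v hv
  rw [idx_ptAct_frobLine, evenDatum_add]

/-- `StdReachable`: `[ℓ] = (×ℓ)·[1]`. [folklore] -/
theorem evenLine_stdReachable : StdReachable (evenLineDictionary q p ℓ b hb) :=
  ⟨[mulAut b hb (ℓ : ℚ) (Nat.cast_ne_zero.2 hℓ.out.ne_zero)], rfl⟩

/-- Hence Y₁ = `AnsatzWithinInd` (E-plan's `ansatzWithinInd_of_moves`, by name). [claim: Joshi2024ATS3, status: disputed] -/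
theorem evenLine_ansatzWithinInd :
    AnsatzWithinInd (scalRegion q) (evenLineDictionary q p ℓ b hb) (P := evenSetting q) :=
  ansatzWithinInd_of_moves _ _ (evenLine_baseIsThetaPilot q p ℓ b hb) (evenLine_movesAreInd q p ℓ b hb)
    (evenLine_datumEquivariant q p ℓ b hb) (evenLine_stdReachable q p ℓ b hb)

omit hℓ in
/-- The read log-volume at the label `1`: `logvol (ρ (Ψ^{(idx y)})) = −(1 + 2·idx y) · log q`. [folklore] -/
theorem logvol_evenDatum (y : (frobLine p ℓ b hb).Pt) :
    ((evenFull q).toLatticeSituation.D (evenSetting q).n).logvol 1 () (scalRegion q (evenDatum q (idx ℓ y)) 1 ()) =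
      -((1 : ℝ) + 2 * (idx ℓ y : ℝ)) * Real.log q := by
  show pVol q 1 () (scalRegion q (evenDatum q (idx ℓ y)) 1 ()) = _
  rw [scalRegion_evenDatum q (show (1 : toyIndex.Label) ≠ 0 by decide), pVol_pBall]
  have : jsq (1 : toyIndex.Label) = 1 := rfl
  rw [this]; push_cast; ring

omit hℓ in
/-- **`ExponentLogFaithful` HOLDS** at `(j, v_ℚ) = (1, ·)` with `κ = −2·log q / log b`, `c = −log q` (`b ≠ 1`): the translated data READ
Joshi's exponent `b^{idx y}` logarithmically. [claim: Joshi2021ATS1, status: disputed] -/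
theorem evenLine_exponentLogFaithful (hb1 : b ≠ 1) :
    ExponentLogFaithful (frobLine p ℓ b hb) (evenFull q).toLatticeSituation (evenSetting q).n (scalRegion q)
      (fun y => evenDatum q (idx ℓ y)) := by
  have hlogb : Real.log b ≠ 0 := Real.log_ne_zero_of_pos_of_ne_one hb hb1
  have hlogq : Real.log q ≠ 0 := (log_p_pos q).ne'
  refine ⟨1, (), -2 * Real.log q / Real.log b, -Real.log q, ?_, fun y => ?_⟩
  · exact div_ne_zero (mul_ne_zero (by norm_num) hlogq) hlogb
  · rw [logvol_evenDatum, exponent_frobLine, Real.log_zpow]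
    field_simp
    ring

/-- `ActionDilates` on the Frobenius line (E-t1's `frobLine_actionDilates`, by name). [claim: Joshi2021ATS1, status: disputed] -/
theorem evenLine_actionDilates (hb1 : b ≠ 1) : (frobLine p ℓ b hb).ActionDilates := frobLine_actionDilates b hb hb1

/-- **`¬ StandardPointIsQPilot`** (else S, by the X-01 skeleton). [claim: Joshi2024ATS3, status: disputed] -/
theorem evenLine_not_standardPointIsQPilot :
    ¬ StandardPointIsQPilot (scalRegion q) (qDatum q) (evenLineDictionary q p ℓ b hb) := fun h =>
  evenSetting_not_pilotKummerIndRelated q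
    (pilotKummerIndRelated_of_ansatzWithinInd _ _ _ (evenLine_ansatzWithinInd q p ℓ b hb) h)

/-! ## 3. Packaging -/

/-- **COUNTERMODEL for the κ-free log read-out.** At the even-power model: the log-faithful, equivariant, dilating [J-I] dictionary on the
Frobenius line has every Y₁-component and `AnsatzWithinInd`, `ExponentLogFaithful` and `ActionDilates` TRUE, while `StandardPointIsQPilot`
and S are FALSE and log-volume is NOT (Ind)-invariant. [claim: Joshi2021ATS1, status: disputed] -/
theorem frobLine_even_countermodel (hb1 : b ≠ 1) :
    Summit.ABC.IUTFork.Joshi.BaseIsThetaPilot (evenLineDictionary q p ℓ b hb) (P := evenSetting q) ∧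
    Summit.ABC.IUTFork.Joshi.MovesAreInd (evenLineDictionary q p ℓ b hb) ∧
    Summit.ABC.IUTFork.Joshi.DatumEquivariant (evenLineDictionary q p ℓ b hb) ∧
    Summit.ABC.IUTFork.Joshi.StdReachable (evenLineDictionary q p ℓ b hb) ∧
    Summit.ABC.IUTFork.Joshi.AnsatzWithinInd (scalRegion q) (evenLineDictionary q p ℓ b hb) (P := evenSetting q) ∧
    Summit.ABC.IUTFork.Joshi.UntiltPoints.ExponentLogFaithful (frobLine p ℓ b hb) (evenFull q).toLatticeSituation (evenSetting q).n
      (scalRegion q) (fun y => evenDatum q (idx ℓ y)) ∧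
    (frobLine p ℓ b hb).ActionDilates ∧
    ¬ ((evenFull q).D (evenSetting q).n).LogvolInvariant ∧
    ¬ Summit.ABC.IUTFork.Joshi.StandardPointIsQPilot (scalRegion q) (qDatum q) (evenLineDictionary q p ℓ b hb) ∧
    ¬ Summit.ABC.IUTFork.Cor312Vol.PilotKummerIndRelated (evenFull q).toLatticeSituation (evenSetting q) (scalRegion q) (qDatum q) :=
  ⟨evenLine_baseIsThetaPilot q p ℓ b hb, evenLine_movesAreInd q p ℓ b hb, evenLine_datumEquivariant q p ℓ b hb,
    evenLine_stdReachable q p ℓ b hb, evenLine_ansatzWithinInd q p ℓ b hb, evenLine_exponentLogFaithful q p ℓ b hb hb1,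
    evenLine_actionDilates p ℓ b hb hb1, evenSetting_not_logvolInvariant q, evenLine_not_standardPointIsQPilot q p ℓ b hb,
    evenSetting_not_pilotKummerIndRelated q⟩

/-- Non-vacuity at concrete parameters: `b = 2`. [folklore] -/
theorem frobLine_two_even_countermodel :
    Summit.ABC.IUTFork.Joshi.UntiltPoints.ExponentLogFaithful (frobLine p ℓ 2 two_pos) (evenFull q).toLatticeSituation
      (evenSetting q).n (scalRegion q) (fun y => evenDatum q (idx ℓ y)) ∧
    (frobLine p ℓ 2 two_pos).ActionDilates ∧
    Summit.ABC.IUTFork.Joshi.MovesAreInd (evenLineDictionary q p ℓ 2 two_pos) ∧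
    Summit.ABC.IUTFork.Joshi.DatumEquivariant (evenLineDictionary q p ℓ 2 two_pos) ∧
    ¬ Summit.ABC.IUTFork.Cor312Vol.PilotKummerIndRelated (evenFull q).toLatticeSituation (evenSetting q) (scalRegion q) (qDatum q) :=
  ⟨evenLine_exponentLogFaithful q p ℓ 2 two_pos (by norm_num), evenLine_actionDilates p ℓ 2 two_pos (by norm_num),
    evenLine_movesAreInd q p ℓ 2 two_pos, evenLine_datumEquivariant q p ℓ 2 two_pos, evenSetting_not_pilotKummerIndRelated q⟩

end Summit.ABC.IUTFork.Joshi.EvenScaling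

end
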